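import Literature.MathematicalPhysics.QuantumLattice.DWaveSourceFreeCumulantBound
import Literature.MathematicalPhysics.QuantumLattice.ComplexSourceCumulantBound

/-!
# The free `d`-wave–sourced torus: a zero-free complex source disc of radius `1/(16β)` and the disc gain bound, from cumulants

Topic `MathematicalPhysics/QuantumLattice`. Composition of the free pair-field cumulant bound
(`dWaveSource_free_pairCumulantBound`, hypothesis (K) at `U = 0`) with the Taylor-interface theorems
of `ComplexSourceCumulantBound.lean`:

`dWaveSource_free_zeroFreeDisc_and_discGain` — for `[μ₁,μ₂] ⊂ (-4,0)` there are `A, B > 0` (the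
cumulant constants, `B = 16`) such that for `β ≥ 1`, `μ ∈ [μ₁,μ₂]`, eventually in `L`:
* `Z_L(h) ≠ 0` for every COMPLEX source with `Bβ‖h‖ < 1` — a quantitative zero-free disc for the
  free BdG torus (the free Lee–Yang theorem `DWaveSourceFreeLeeYang` puts all zeros on the imaginary
  axis; this adds the gap `|h| ≥ 1/(Bβ)` around the origin, uniformly in `L`);
* for real `s` with `Bβ|s| ≤ 1/2`: `|p̃_L(s) - p̃_L(0)| ≤ 2A(1+log β)s²` — a third, independent route
  to the free thermal-disc bound (after the direct BdG estimate `DWaveSourceFreeGainBound` and the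
  Lee–Yang/GHS route `DWaveSourceFreeLeeYang`), and the `U = 0` instance of
  `Summits/…/ThermalWedgeTwSourcedInertnessDiscOfCumulants.twThermalDisc_of_pairCumulantBound`.

Everything is PROVED; no definition is introduced.

## References

* D. Ruelle, *Statistical Mechanics: Rigorous Results* (1969), §4.4. [Ruelle1969]
* T. D. Lee, C. N. Yang, Phys. Rev. 87 (1952) 410. [LeeYang1952]
-/

noncomputable section

open Complex Finset
open scoped Nat Matrix.Norms.L2Operator ComplexOrder
open Matrix Literature.Probability.LatticeModels

namespace Literature.MathematicalPhysics.QuantumLattice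

/-- **A zero-free complex source disc of radius `∝ 1/β` and the disc gain bound for the free
`d`-wave–sourced torus, from its zero-source cumulants.** For `[μ₁,μ₂] ⊂ (-4,0)` there are
`A, B > 0` (those of `dWaveSource_free_pairCumulantBound`: `B = 16`) such that for `β ≥ 1`,
`μ ∈ [μ₁,μ₂]`, eventually in `L`: `Z_L(h) ≠ 0` for every complex `h` with `Bβ‖h‖ < 1`, and
`|p̃_L(s) - p̃_L(0)| ≤ 2A(1 + log β)s²` for every real `s` with `Bβ|s| ≤ 1/2`. [cite: Ruelle1969, §4.4] -/
theorem dWaveSource_free_zeroFreeDisc_and_discGain :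
    ∀ μ₁ μ₂ : ℝ, -4 < μ₁ → μ₁ ≤ μ₂ → μ₂ < 0 → ∃ A B : ℝ, 0 < A ∧ 0 < B ∧
      ∀ β : ℝ, 1 ≤ β → ∀ μ ∈ Set.Icc μ₁ μ₂, ∃ L₀ : ℕ, ∀ (L : ℕ) [NeZero L], L₀ ≤ L →
      (∀ h : ℂ, B * β * ‖h‖ < 1 →
        partitionFn β (hubbardTorusWith 2 L 1 0 μ -
          h • (pairField dWaveFormFactor L + (pairField dWaveFormFactor L)ᴴ)) ≠ 0) ∧
      (∀ s : ℝ, B * β * |s| ≤ 1 / 2 →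
        |Real.log (partitionFn β (dWaveSourceTorus L 0 μ s)).re / (β * (L : ℝ) ^ 2) -
            Real.log (partitionFn β (dWaveSourceTorus L 0 μ 0)).re / (β * (L : ℝ) ^ 2)| ≤
          2 * A * (1 + Real.log β) * s ^ 2) := by
  intro μ₁ μ₂ h4 h12 h0
  obtain ⟨A, B, hA, hB, hreg⟩ := dWaveSource_free_pairCumulantBound μ₁ μ₂ h4 h12 h0
  refine ⟨A, B, hA, hB, fun β hβ μ hμ => ?_⟩
  obtain ⟨L₀, hL₀⟩ := hreg β hβ μ hμ
  refine ⟨L₀, fun L _ hL => ?_⟩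
  have hβ0 : 0 < β := by linarith
  have hL2 : (0 : ℝ) < (L : ℝ) ^ 2 := by
    have : (0 : ℝ) < L := Nat.cast_pos.2 (Nat.pos_of_ne_zero (NeZero.ne L))
    positivity
  have hβL : 0 < β * (L : ℝ) ^ 2 := mul_pos hβ0 hL2
  have hlog : 0 ≤ 1 + Real.log β := by have := Real.log_nonneg hβ; linarith
  have hA' : 0 ≤ A * (1 + Real.log β) * (β * (L : ℝ) ^ 2) := by positivity
  have hB' : 0 ≤ B * β := by positivity
  have hK := hL₀ L hL
  refine ⟨fun h hh => ?_, fun s hs => ?_⟩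
  · exact partitionFn_dWaveSource_ne_zero_of_taylor_bound L β 0 μ hA' hB' hK
      (by simpa [mul_assoc] using hh)
  · have key := dWaveSource_abs_sourcedGain_le_of_taylor_bound L hβ0 0 μ hA' hB' hK
      (s := s) (by simpa [mul_assoc] using hs)
    refine key.trans (le_of_eq ?_)
    rw [div_eq_iff hβL.ne']
    ring

end Literature.MathematicalPhysics.QuantumLattice
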